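import Mathlib.RepresentationTheory.Basic
import Mathlib.LinearAlgebra.Quotient.Basic
import Mathlib.LinearAlgebra.Prod
import Mathlib.Algebra.Module.Projective
import Literature.RepresentationTheory.OneCocycleExtension
import Literature.RepresentationTheory.FirstOrderDeformationInvariantSubspace
import Literature.RepresentationTheory.CocycleExtensionTransversal
import HarnessLib

/-!
# Transfer of an equivariant map into the jet module to the window model («WINDOW TRANSFER»)

Generic representation theory over a commutative ring `k` (any monoid `G`), Mathlib-only, THEOREMS ONLY (no `def`, no instance, no named
fact); letters of the tree's `FirstOrderJetIntertwiner` (the JET MODULE `ρ` of a first-order deformation pair `(π₀, π₁)` on `V × V`,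
`ρ g (v₀, v₁) = (π₀ g v₀, π₁ g v₀ + π₀ g v₁)`), `FirstOrderDeformationInvariantSubspace` (a `π₀`-invariant `A ≤ V`, the block cocycle
`c̄ g = mkQ_A ∘ π₁ g ∘ ι_A` and the WINDOW MODEL `E` on `(V ⧸ A) × A`, `E g (u, a) = (π̄₀ g u + c̄ g a, π₀|_A g a)`) and
`CocycleExtensionTransversal` (transversals of `E`).

THE SITUATION.  A representation `τ` on `X` and a `k`-linear `φ : X → V × V` equivariant into the jet module (`φ (τ g x) = ρ g (φ x)`)
whose first components lie in `A` (`∀ x, (φ x).1 ∈ A` — «`φ` lands in the window `A × V`»).  The TRANSFERRED MAP is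
`ψ x := (mkQ_A (φ x).2, (φ x).1) : X → (V ⧸ A) × A` (the window map `(a, v) ↦ (mkQ v, a)` after `φ`); it is handled hypothesis-style
(`hψ₁ : ∀ x, (ψ x).1 = mkQ (φ x).2`, `hψ₂ : ∀ x, ((ψ x).2 : V) = (φ x).1`) and supplied by `exists_windowTransfer`.

* §1 `exists_windowTransfer` (the map exists), **`windowTransfer_equivariant`** (`ψ (τ g x) = E g (ψ x)`).
* §2 The two transversality conditions of `CocycleExtensionTransversal` §3 read on `φ`:
  `disjoint_range_windowTransfer_iff` («`Disjoint (range ψ) (ker snd)` ⟺ `φ(X) ∩ (0 × V) ⊆ 0 × A`», i.e.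
  `∀ x, (φ x).1 = 0 → (φ x).2 ∈ A`) and `surjective_snd_windowTransfer_iff` («`snd ∘ ψ` onto ⟺ the first components of `φ` fill `A`»).
* §3 CONSEQUENCES: `coboundary_of_equivariant_map_jet` — such a `φ` with both conditions makes the block cocycle a coboundary, hence
  (`deforms_of_equivariant_map_jet`, `A` projective) `A` deforms to first order; contrapositively **`not_fills_of_not_deforms`**: if `A` does
  NOT deform to first order then no equivariant `φ : X → jet` with `φ(X) ∩ (0 × V) ⊆ 0 × A` has first components filling `A`.

SOURCES (what is formalised, read at our letters).  This is bookkeeping on top of [HuybrechtsLehn1997, App. 2.A.7 (Flags of subsheaves)]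
(first-order deformations of a sub-object along a deformation of the ambient object are governed by the off-diagonal block, a 1-cocycle,
and exist iff it is a coboundary) and [Brown1982, Ch. IV §2 Prop. 2.1 p. 87, Prop. 2.3 p. 89] (complements ∕ splittings of an extension ↔
principal derivations): a module mapping equivariantly into the first-order thickening with image inside the window projects to the
sub-quotient `window ∕ (0 × A) = E_{c̄}`, and the image is a complement there exactly under the two conditions of §2.  Deliberately NOT
here: anything specific to induced representations or to the groups where this is applied (the consumer supplies `τ`, `φ`).
-/

set_option autoImplicit false

namespace Literature.RepresentationTheory

variable {k : Type*} [CommRing k] {G : Type*} [Monoid G] {V : Type*} [AddCommGroup V] [Module k V]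
variable {X : Type*} [AddCommGroup X] [Module k X]

/-! ## §1 The transferred map and its equivariance -/

omit [Monoid G] in
/-- **THE TRANSFERRED MAP EXISTS.**  For `φ : X →ₗ V × V` with first components in `A` there is a `k`-linear `ψ : X →ₗ (V ⧸ A) × A` with
`(ψ x).1 = mkQ (φ x).2` and `((ψ x).2 : V) = (φ x).1`. [cite: HuybrechtsLehn1997, App. 2.A.7 (Flags of subsheaves)] -/
theorem exists_windowTransfer (A : Submodule k V) (φ : X →ₗ[k] V × V) (hA : ∀ x, (φ x).1 ∈ A) :
    ∃ ψ : X →ₗ[k] (V ⧸ A) × A, ∀ x, (ψ x).1 = Submodule.Quotient.mk (φ x).2 ∧ ((ψ x).2 : V) = (φ x).1 := by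
  refine ⟨LinearMap.prod (A.mkQ ∘ₗ LinearMap.snd k V V ∘ₗ φ)
      (LinearMap.codRestrict A (LinearMap.fst k V V ∘ₗ φ) fun x => hA x), fun x => ⟨rfl, rfl⟩⟩

/-- **THE TRANSFERRED MAP IS EQUIVARIANT INTO THE WINDOW MODEL.**  If `φ` intertwines `τ` with the jet representation `ρ` of `(π₀, π₁)` and
lands in the window over the `π₀`-invariant `A`, then `ψ (τ g x) = E g (ψ x)` for the window model `E` of the block cocycle.
[cite: HuybrechtsLehn1997, App. 2.A.7 (Flags of subsheaves)] -/
theorem windowTransfer_equivariant (π₀ : Representation k G V) (π₁ : G → Module.End k V) (ρ : Representation k G (V × V))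
    (hρ : ∀ g v₀ v₁, ρ g (v₀, v₁) = (π₀ g v₀, π₁ g v₀ + π₀ g v₁)) (A : Submodule k V) (hAinv : ∀ g, A ≤ A.comap (π₀ g))
    (c : G → A →ₗ[k] V ⧸ A) (hc : ∀ g, c g = A.mkQ ∘ₗ π₁ g ∘ₗ A.subtype) (E : Representation k G ((V ⧸ A) × A))
    (hE : ∀ g u a, E g (u, a) = (π₀.quotient A hAinv g u + c g a, π₀.subrepresentation A hAinv g a))
    (τ : Representation k G X) (φ : X →ₗ[k] V × V) (hφ : ∀ g x, φ (τ g x) = ρ g (φ x))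
    (ψ : X →ₗ[k] (V ⧸ A) × A) (hψ : ∀ x, (ψ x).1 = Submodule.Quotient.mk (φ x).2 ∧ ((ψ x).2 : V) = (φ x).1) (g : G) (x : X) :
    ψ (τ g x) = E g (ψ x) := by
  have hφx : φ x = (((ψ x).2 : V), (φ x).2) := Prod.ext (hψ x).2.symm rfl
  have h1 := fst_cocycleRep_mk_eq π₀ π₁ ρ hρ A hAinv c hc E hE g (ψ x).2 (φ x).2
  have h2 := snd_cocycleRep_mk_eq π₀ π₁ ρ hρ A hAinv c E hE g (ψ x).2 (φ x).2
  rw [← hφx, ← hφ] at h1 h2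
  have hEx : E g (ψ x) = E g (Submodule.Quotient.mk (φ x).2, (ψ x).2) := by
    rw [← (hψ x).1]
  rw [hEx]
  refine Prod.ext ?_ (Subtype.ext ?_)
  · rw [(hψ (τ g x)).1, h1]
  · rw [(hψ (τ g x)).2, h2]

/-! ## §2 The two transversality conditions read on `φ` -/

omit [Monoid G] in
/-- **DISJOINTNESS FROM THE SUB ⟺ `φ(X) ∩ (0 × V) ⊆ 0 × A`**: `Disjoint (range ψ) (ker snd) ↔ ∀ x, (φ x).1 = 0 → (φ x).2 ∈ A`.
[cite: Brown1982, Ch. IV §2 Prop. 2.1 p. 87] -/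
theorem disjoint_range_windowTransfer_iff (A : Submodule k V) (φ : X →ₗ[k] V × V)
    (ψ : X →ₗ[k] (V ⧸ A) × A) (hψ : ∀ x, (ψ x).1 = Submodule.Quotient.mk (φ x).2 ∧ ((ψ x).2 : V) = (φ x).1) :
    Disjoint (LinearMap.range ψ) (LinearMap.ker (LinearMap.snd k (V ⧸ A) A)) ↔ ∀ x, (φ x).1 = 0 → (φ x).2 ∈ A := by
  rw [Submodule.disjoint_def]
  constructor
  · intro H x hx
    have hmem : ψ x ∈ LinearMap.ker (LinearMap.snd k (V ⧸ A) A) := by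
      rw [LinearMap.mem_ker, LinearMap.snd_apply]
      exact Subtype.ext (by rw [(hψ x).2, hx, Submodule.coe_zero])
    have h0 := H (ψ x) (LinearMap.mem_range_self ψ x) hmem
    have h1 : (ψ x).1 = 0 := by rw [h0, Prod.fst_zero]
    rw [(hψ x).1] at h1
    exact (Submodule.Quotient.mk_eq_zero A).mp h1
  · rintro H y ⟨x, rfl⟩ hker
    rw [LinearMap.mem_ker, LinearMap.snd_apply] at hker
    have hx : (φ x).1 = 0 := by rw [← (hψ x).2, hker, Submodule.coe_zero]
    refine Prod.ext ?_ hker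
    rw [(hψ x).1, Prod.fst_zero]
    exact (Submodule.Quotient.mk_eq_zero A).mpr (H x hx)

omit [Monoid G] in
/-- **ONTO THE QUOTIENT ⟺ THE FIRST COMPONENTS OF `φ` FILL `A`**: `Surjective (snd ∘ ψ) ↔ ∀ a ∈ A, ∃ x, (φ x).1 = a`.
[cite: Brown1982, Ch. IV §2 Prop. 2.1 p. 87] -/
theorem surjective_snd_windowTransfer_iff (A : Submodule k V) (φ : X →ₗ[k] V × V)
    (ψ : X →ₗ[k] (V ⧸ A) × A) (hψ : ∀ x, (ψ x).1 = Submodule.Quotient.mk (φ x).2 ∧ ((ψ x).2 : V) = (φ x).1) :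
    Function.Surjective (LinearMap.snd k (V ⧸ A) A ∘ₗ ψ) ↔ ∀ a ∈ A, ∃ x, (φ x).1 = a := by
  constructor
  · intro H a ha
    obtain ⟨x, hx⟩ := H ⟨a, ha⟩
    refine ⟨x, ?_⟩
    rw [← (hψ x).2]
    exact congrArg Subtype.val hx
  · rintro H ⟨a, ha⟩
    obtain ⟨x, hx⟩ := H a ha
    exact ⟨x, Subtype.ext (by rw [LinearMap.comp_apply, LinearMap.snd_apply, (hψ x).2, hx])⟩

/-! ## §3 Consequences: coboundary, deformation, non-degeneracy -/

/-- **AN EQUIVARIANT MAP INTO THE JET MODULE WITH TRANSVERSAL WINDOW IMAGE MAKES THE BLOCK COCYCLE A COBOUNDARY.**  If `φ : X → V × V`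
intertwines `τ` with the jet representation, lands in the window over `A`, meets `0 × V` only inside `0 × A`, and its first components fill
`A`, then `c̄ g = t ∘ π₀|_A g - π̄₀ g ∘ t` for some `t`.  Any commutative ring `k`.
[cite: HuybrechtsLehn1997, App. 2.A.7 (Flags of subsheaves)] [cite: Brown1982, Ch. IV §2 Prop. 2.3 p. 89] -/
theorem coboundary_of_equivariant_map_jet (π₀ : Representation k G V) (π₁ : G → Module.End k V) (h1 : π₁ 1 = 0)
    (hL : ∀ g h, π₁ (g * h) = π₁ g * π₀ h + π₀ g * π₁ h) (ρ : Representation k G (V × V))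
    (hρ : ∀ g v₀ v₁, ρ g (v₀, v₁) = (π₀ g v₀, π₁ g v₀ + π₀ g v₁)) (A : Submodule k V) (hAinv : ∀ g, A ≤ A.comap (π₀ g))
    (c : G → A →ₗ[k] V ⧸ A) (hc : ∀ g, c g = A.mkQ ∘ₗ π₁ g ∘ₗ A.subtype)
    (τ : Representation k G X) (φ : X →ₗ[k] V × V) (hφ : ∀ g x, φ (τ g x) = ρ g (φ x)) (hA : ∀ x, (φ x).1 ∈ A)
    (hmeet : ∀ x, (φ x).1 = 0 → (φ x).2 ∈ A) (hfill : ∀ a ∈ A, ∃ x, (φ x).1 = a) :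
    ∃ t : A →ₗ[k] V ⧸ A, ∀ g, c g = t ∘ₗ π₀.subrepresentation A hAinv g - π₀.quotient A hAinv g ∘ₗ t := by
  obtain ⟨E, hE⟩ := exists_representation_jetBlock π₀ π₁ h1 hL A hAinv c hc
  obtain ⟨ψ, hψ⟩ := exists_windowTransfer A φ hA
  exact coboundary_of_equivariant_map_transversal (π₀.quotient A hAinv) (π₀.subrepresentation A hAinv) c E hE τ ψ
    (windowTransfer_equivariant π₀ π₁ ρ hρ A hAinv c hc E hE τ φ hφ ψ hψ)
    ((disjoint_range_windowTransfer_iff A φ ψ hψ).mpr hmeet) ((surjective_snd_windowTransfer_iff A φ ψ hψ).mpr hfill)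

/-- **… HENCE `A` DEFORMS TO FIRST ORDER** (for `A` projective over `k`, e.g. `k` a field): under the hypotheses of
`coboundary_of_equivariant_map_jet`, `∃ L : A →ₗ V, ∀ g a, π₁ g a + π₀ g (L a) - L (π₀ g a) ∈ A`.
[cite: HuybrechtsLehn1997, App. 2.A.7 (Flags of subsheaves)] -/
theorem deforms_of_equivariant_map_jet (π₀ : Representation k G V) (π₁ : G → Module.End k V) (h1 : π₁ 1 = 0)
    (hL : ∀ g h, π₁ (g * h) = π₁ g * π₀ h + π₀ g * π₁ h) (ρ : Representation k G (V × V))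
    (hρ : ∀ g v₀ v₁, ρ g (v₀, v₁) = (π₀ g v₀, π₁ g v₀ + π₀ g v₁)) (A : Submodule k V) [Module.Projective k A]
    (hAinv : ∀ g, A ≤ A.comap (π₀ g)) (τ : Representation k G X) (φ : X →ₗ[k] V × V)
    (hφ : ∀ g x, φ (τ g x) = ρ g (φ x)) (hA : ∀ x, (φ x).1 ∈ A) (hmeet : ∀ x, (φ x).1 = 0 → (φ x).2 ∈ A)
    (hfill : ∀ a ∈ A, ∃ x, (φ x).1 = a) :
    ∃ L : A →ₗ[k] V, ∀ g (a : A), π₁ g (a : V) + π₀ g (L a) - L (π₀.subrepresentation A hAinv g a) ∈ A :=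
  (deforms_iff_jetBlock_coboundary π₀ π₁ A hAinv (fun g => A.mkQ ∘ₗ π₁ g ∘ₗ A.subtype) fun _ => rfl).mpr
    (coboundary_of_equivariant_map_jet π₀ π₁ h1 hL ρ hρ A hAinv (fun g => A.mkQ ∘ₗ π₁ g ∘ₗ A.subtype) (fun _ => rfl)
      τ φ hφ hA hmeet hfill)

/-- **NON-DEGENERACY FORM.**  If `A` does NOT deform to first order along `(π₀, π₁)` (`A` projective over `k`), then an equivariant
`φ : X → V × V` into the jet module which lands in the window over `A` and meets `0 × V` only inside `0 × A` cannot have first components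
filling `A`: some `a ∈ A` is not of the form `(φ x).1`. [cite: HuybrechtsLehn1997, App. 2.A.7 (Flags of subsheaves)] -/
theorem not_fills_of_not_deforms (π₀ : Representation k G V) (π₁ : G → Module.End k V) (h1 : π₁ 1 = 0)
    (hL : ∀ g h, π₁ (g * h) = π₁ g * π₀ h + π₀ g * π₁ h) (ρ : Representation k G (V × V))
    (hρ : ∀ g v₀ v₁, ρ g (v₀, v₁) = (π₀ g v₀, π₁ g v₀ + π₀ g v₁)) (A : Submodule k V) [Module.Projective k A]
    (hAinv : ∀ g, A ≤ A.comap (π₀ g))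
    (hnd : ¬ ∃ L : A →ₗ[k] V, ∀ g (a : A), π₁ g (a : V) + π₀ g (L a) - L (π₀.subrepresentation A hAinv g a) ∈ A)
    (τ : Representation k G X) (φ : X →ₗ[k] V × V) (hφ : ∀ g x, φ (τ g x) = ρ g (φ x)) (hA : ∀ x, (φ x).1 ∈ A)
    (hmeet : ∀ x, (φ x).1 = 0 → (φ x).2 ∈ A) :
    ∃ a ∈ A, ∀ x, (φ x).1 ≠ a := by
  by_contra hcon
  push Not at hcon
  exact hnd (deforms_of_equivariant_map_jet π₀ π₁ h1 hL ρ hρ A hAinv τ φ hφ hA hmeet hcon)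

end Literature.RepresentationTheory
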